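import Literature.Barriers.HodgeConjecture.GeneralizedHodgeTrivialReasonsSubHodgeLeaves
import Literature.Barriers.HodgeConjecture.GeneralizedHodgeTrivialReasonsConiveauProofs
import Literature.Barriers.HodgeConjecture.GeneralizedHodgeTrivialReasonsDischarge
import Literature.AlgebraicGeometry.HodgeTheory.GysinKernelSplitHolds
import Literature.AlgebraicGeometry.HodgeTheory.SupportedClassesHodgeConiveauOfDeligne
import HarnessLib

/-!
# Grothendieck 1969, "Hodge's general conjecture is false for trivial reasons" — the barrier holds

Topic `Literature/Barriers/HodgeConjecture`; proofs-only file (no definitions, no new named facts).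
With Deligne's *Hodge III* Prop. 8.2.7 proved in the tree
(`Deligne1974_ker_pullback_eq_ker_pullback_resolution_holds`, `HodgeTheory/GysinKernelSplitHolds`),
hence Cor. 8.2.8 (`…_holds_of`, `HodgeTheory/GysinKernelSplit`) and Grothendieck's coniveau fact
(`HodgeTheory.Grothendieck1969_supportedClasses_le_hodgeConiveau_holds`,
`HodgeTheory/SupportedClassesHodgeConiveauHolds`, librarian g29; its term is repeated privately
below), every remaining named fact of the `GeneralizedHodgeTrivialReasons*` family closes by ONE
TERM through reductions already accepted in this directory:

* `Grothendieck1969_supportedClasses_isSubHodge_holds` — the sub-Hodge property of the coniveau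
  classes (Grothendieck p. 300 / Deligne), via `…_isSubHodge_holds_of` (`…SubHodgeLeaves`) fed with
  Cor. 8.2.8 and de Rham's theorem in multiplicative form (`exists_deRhamIsoFamily_holds`);
* `Grothendieck1969_supportedClasses_le_hodgeFiltration_holds` — Grothendieck's (∗), p. 299, via
  `…_le_hodgeFiltration_of_hodgeConiveau` (`…ConiveauProofs`);
* `Grothendieck1969_rationalSupportedClasses_evenRank_holds` — `Nᵖ Hⁱ` has even rank for `i` odd,
  via `…_evenRank_of_deRham` (`…SubHodgeOfFacts`) with Hironaka, Hodge models, model-independence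
  of `H^{p,q}`, de Rham and a real Hodge model all taken from their accepted discharges;
* `Grothendieck1969_ellipticCurveCubed_oddRank_holds` — the odd rank on `E_τ³`, via
  `…_oddRank_of_hodgeDecomposition_of_hodgeConiveau` (`…ConiveauProofs`) and the proved Hodge
  decomposition of `H³(E_τ³)` (`…_hodgeDecomposition_holds`, `…Discharge`);
* `Grothendieck1969_generalHodgeConjecture_false_holds` — **the barrier statement itself**
  (`GeneralizedHodgeTrivialReasons.lean`: the general Hodge conjecture as originally formulated
  fails on `E_τ³`), via `…_false_of_hodgeDecomposition_of_hodgeConiveau` (`…TorusSymmetryProofs`).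

Found by the librarian's forward-chaining census (sweep g29, 2026-08-16).
-/

noncomputable section

namespace Literature.Barriers.HodgeConjecture

open Literature.AlgebraicGeometry.HodgeTheory
open scoped Manifold

/-- Deligne, *Hodge III*, Cor. 8.2.8, from the proved Prop. 8.2.7 (the term of
`HodgeTheory/SaitoGrFDeRhamCurveNetHolds`, repeated here to keep this file's imports inside the
`GeneralizedHodgeTrivialReasons*` / `SupportedClassesHodgeConiveau*` closures).
[cite: DeligneHodgeIII1974, Prop. 8.2.7 and Cor. 8.2.8 (p. 40)] -/
private theorem deligne828 : Deligne1974_ker_restrictCompl_eq_iSup_range_complexGysin :=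
  Deligne1974_ker_restrictCompl_eq_iSup_range_complexGysin_holds_of
    Deligne1974_ker_pullback_eq_ker_pullback_resolution_holds

/-- Grothendieck's coniveau fact, by the term of
`HodgeTheory.Grothendieck1969_supportedClasses_le_hodgeConiveau_holds`
(`HodgeTheory/SupportedClassesHodgeConiveauHolds`, librarian g29), repeated privately so that this
file elaborates independently of that sibling's build.
[cite: GrothendieckTopology1969, p. 299 (∗) and p. 300] [cite: DeligneHodgeIII1974, Cor. 8.2.8] -/
private theorem coniveau : Grothendieck1969_supportedClasses_le_hodgeConiveau :=
  Grothendieck1969_supportedClasses_le_hodgeConiveau_of_deligne' deligne828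

/-- **The coniveau classes form a sub-Hodge structure — holds** (Grothendieck 1969, p. 300 and
footnote †; Deligne, *Hodge III*, Cor. 8.2.8; Voisin I §7.3.2). One term: `…_isSubHodge_holds_of`
applied to Cor. 8.2.8 and de Rham's theorem with products.
[cite: GrothendieckTopology1969, p. 300 and footnote †] [cite: DeligneHodgeIII1974, Cor. 8.2.8] -/
theorem Grothendieck1969_supportedClasses_isSubHodge_holds :
    Grothendieck1969_supportedClasses_isSubHodge :=
  Grothendieck1969_supportedClasses_isSubHodge_holds_of deligne828
    (fun E _ _ _ ↦ Literature.NumberTheory.Transcendental.exists_deRhamIsoFamily_holds E)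

/-- **Grothendieck's (∗), p. 299 — holds**: the rational classes supported in codimension `≥ p`
pull back into `Fᵖ Hⁱ` in every Hodge model. One term: (∗) from the Hodge-coniveau fact.
[cite: GrothendieckTopology1969, p. 299 (∗) and p. 300] -/
theorem Grothendieck1969_supportedClasses_le_hodgeFiltration_holds :
    Grothendieck1969_supportedClasses_le_hodgeFiltration :=
  Grothendieck1969_supportedClasses_le_hodgeFiltration_of_hodgeConiveau
    coniveau

/-- **`Nᵖ Hⁱ(X(ℂ); ℚ)` has even rank for `i` odd — holds.** One term: `…_evenRank_of_deRham` with
Deligne's Cor. 8.2.8, Hironaka, Hodge models, model-independence of `H^{p,q}`, de Rham's theorem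
and a real Hodge model, each from its accepted discharge.
[cite: GrothendieckTopology1969, pp. 299–300] [cite: DeligneHodgeIII1974, Cor. 8.2.8] -/
theorem Grothendieck1969_rationalSupportedClasses_evenRank_holds :
    Grothendieck1969_rationalSupportedClasses_evenRank :=
  Grothendieck1969_rationalSupportedClasses_evenRank_of_deRham deligne828
    Literature.AlgebraicGeometry.Resolution.Hironaka1964_projective_holds
    (fun _ _ ↦ nonempty_hodgeModel_holds) hodgePQ_independent_of_hodgeModel_holds
    (fun E _ _ _ ↦ Literature.NumberTheory.Transcendental.exists_deRhamIsoFamily_holds E)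
    exists_isReal_hodgeModel_holds

/-- **Grothendieck's odd rank on `E_τ³` — holds**: for a cubic `τ`, the classes of `H³(E_τ³; ℚ)`
supported on divisors form a subspace of odd rank in a Hodge model. One term: the proved Hodge
decomposition of `H³(E_τ³)` and the coniveau fact. [cite: GrothendieckTopology1969, pp. 299–300] -/
theorem Grothendieck1969_ellipticCurveCubed_oddRank_holds :
    Grothendieck1969_ellipticCurveCubed_oddRank :=
  Grothendieck1969_ellipticCurveCubed_oddRank_of_hodgeDecomposition_of_hodgeConiveau
    Grothendieck1969_ellipticCurveCubed_hodgeDecomposition_holds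
    coniveau

/-- **Grothendieck 1969: Hodge's general conjecture, as originally formulated, is false — holds.**
The barrier statement `Grothendieck1969_generalHodgeConjecture_false` (the coniveau filtration
`N¹H³(E_τ³; ℚ)` is not `F¹H³ ∩ H³(ℚ)` for a cubic `τ`) follows by one term from the proved Hodge
decomposition of `H³(E_τ³)`, the sub-Hodge property of the coniveau classes and the coniveau fact.
[cite: GrothendieckTopology1969, pp. 299–300] -/
theorem Grothendieck1969_generalHodgeConjecture_false_holds :
    Grothendieck1969_generalHodgeConjecture_false :=
  Grothendieck1969_generalHodgeConjecture_false_of_hodgeDecomposition_of_hodgeConiveau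
    Grothendieck1969_ellipticCurveCubed_hodgeDecomposition_holds
    Grothendieck1969_supportedClasses_isSubHodge_holds
    coniveau

end Literature.Barriers.HodgeConjecture

end
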